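import Summits.Ventures.DiscreteObjects.PP12.FanoFiveSignParity

/-!
# PP(12), order 5: the distance profile `(4, 9, 2)` of the rows of `E` in designs g10's sign/Gram system (kernel)
Framing: lottery ticket; floor = certified bounds/negative ranges.

Cell pub-namedobj (venture DiscreteObjects), target (M), designs gen 17; continues `FanoFiveSignParity` (designs g10 FAMILY-P5PLANE §4,
'consequences'). For `FanoFive.IsSignSystem I m E Es R` and a row `O`:
* `ip_self = 10`, `sum_ip = 36`, `sum_ip_erase = 26` (row and column sums of `R` are `6`);
* `inner_add_inner_of_ip_four`: if `ip(O, O₁) = 4` (`E_{O₁} = −E_O` off one coordinate) then `⟨E_v, E_O⟩ + ⟨E_v, E_{O₁}⟩ = ±2` for every row `v`;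
* `ip_eq_four_of_two_two`: two rows sharing a `2`-column ('chord-mates') have `ip = 4`; `ip_ne_four_of_two_one` / `_of_one_two`: a `(2,1)` or
  `(1,2)` coincidence forces `ip ≠ 4` (apply the previous lemma to the chord-mate pair of that column); hence **`exists_two_two_of_ip_four`**:
  `ip(O, X) = 4` iff `O, X` share a `2`-column, and **`card_ip_four = 2`** (the two chord-mates), `card_ip_two = 9`, `card_ip_zero = 4`;
* in terms of `E`: from every row exactly `2 / 9 / 4` other rows at inner product `−5 / −1 / 3` (Hamming distance `6 / 4 / 2`):
  **`card_inner_neg_five`, `card_inner_neg_one`, `card_inner_three`** — the hypothesis of designs g10's `codeB.c`.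
Pure finite combinatorics over `ℤ`; nothing here asserts any census statement. No `sorry`, no new axioms.
-/

namespace Summit.Ventures.DiscreteObjects.PP12

open Finset

namespace FanoFive

namespace IsSignSystem

variable {I : Fin 7 → Fin 7 → Bool} {m : Fin 7 → Fin 7 → ℤ} {E Es : Fin 16 → Fin 7 → ℤ} {R : Fin 16 → Fin 16 → ℤ}

/-- an entry of `R` as indicators -/
theorem R_eq_ind (h : IsSignSystem I m E Es R) (O N : Fin 16) :
    R O N = (if R O N = 1 then 1 else 0 : ℤ) + 2 * (if R O N = 2 then 1 else 0 : ℤ) := by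
  rcases h.R_range O N with h1 | h1 | h1 <;> norm_num [h1]

/-- a squared entry of `R` as indicators -/
theorem R_sq_eq_ind (h : IsSignSystem I m E Es R) (O N : Fin 16) :
    R O N * R O N = (if R O N = 1 then 1 else 0 : ℤ) + 4 * (if R O N = 2 then 1 else 0 : ℤ) := by
  rcases h.R_range O N with h1 | h1 | h1 <;> norm_num [h1]

/-- row sums of `R` are `6` -/
theorem R_row_sum (h : IsSignSystem I m E Es R) (O : Fin 16) : ∑ N, R O N = 6 := by
  rw [Finset.sum_congr rfl fun N _ => R_eq_ind h O N, Finset.sum_add_distrib, ← Finset.mul_sum, Finset.sum_boole, Finset.sum_boole,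
    (h.R_row_profile O).1, (h.R_row_profile O).2]
  norm_num

/-- column sums of `R` are `6` -/
theorem R_col_sum (h : IsSignSystem I m E Es R) (N : Fin 16) : ∑ O, R O N = 6 := by
  rw [Finset.sum_congr rfl fun O _ => R_eq_ind h O N, Finset.sum_add_distrib, ← Finset.mul_sum, Finset.sum_boole, Finset.sum_boole,
    (h.R_col_profile N).1, (h.R_col_profile N).2]
  norm_num

/-- `ip(O, O) = 10` -/
theorem ip_self (h : IsSignSystem I m E Es R) (O : Fin 16) : ip R O O = 10 := by
  unfold ip
  rw [Finset.sum_congr rfl fun N _ => R_sq_eq_ind h O N, Finset.sum_add_distrib, ← Finset.mul_sum, Finset.sum_boole, Finset.sum_boole,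
    (h.R_row_profile O).1, (h.R_row_profile O).2]
  norm_num

/-- `ip` is symmetric -/
theorem ip_comm (R : Fin 16 → Fin 16 → ℤ) (O X : Fin 16) : ip R O X = ip R X O := by
  unfold ip
  exact Finset.sum_congr rfl fun N _ => mul_comm _ _

/-- `Σ_X ip(O, X) = 36` -/
theorem sum_ip (h : IsSignSystem I m E Es R) (O : Fin 16) : ∑ X, ip R O X = 36 := by
  unfold ip
  rw [Finset.sum_comm]
  have e : ∀ N, ∑ X, R O N * R X N = R O N * 6 := fun N => by rw [← Finset.mul_sum, R_col_sum h N]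
  rw [Finset.sum_congr rfl fun N _ => e N, ← Finset.sum_mul, R_row_sum h O]
  norm_num

/-- `Σ_{X ≠ O} ip(O, X) = 26` -/
theorem sum_ip_erase (h : IsSignSystem I m E Es R) (O : Fin 16) : ∑ X ∈ univ.erase O, ip R O X = 26 := by
  have e := Finset.add_sum_erase univ (fun X => ip R O X) (mem_univ O)
  rw [sum_ip h, ip_self h] at e
  linarith

/-- a single term is bounded by `ip` -/
theorem term_le_ip (h : IsSignSystem I m E Es R) (O X N : Fin 16) : R O N * R X N ≤ ip R O X := by
  unfold ip
  refine Finset.single_le_sum (f := fun N => R O N * R X N) (fun N' _ => mul_nonneg ?_ ?_) (mem_univ N)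
  · rcases h.R_range O N' with h1 | h1 | h1 <;> rw [h1] <;> norm_num
  · rcases h.R_range X N' with h1 | h1 | h1 <;> rw [h1] <;> norm_num

/-- the inner product of a row of `E` with itself is `7` -/
theorem inner_self (h : IsSignSystem I m E Es R) (O : Fin 16) : ∑ x, E O x * E O x = 7 := by
  have : ∀ x, E O x * E O x = 1 := fun x => by rcases h.E_sign O x with h1 | h1 <;> rw [h1] <;> norm_num
  simp_rw [this]; simp

/-- `⟨E_O, E_X⟩ = 3 − 2 ip(O, X)` for `O ≠ X` -/
theorem inner_eq_of_ne (h : IsSignSystem I m E Es R) {O X : Fin 16} (hne : O ≠ X) : ∑ x, E O x * E X x = 3 - 2 * ip R O X := by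
  have hg := h.gram_R_rows O X
  rw [if_neg hne] at hg
  unfold ip; linarith

/-- **if `ip(O, O₁) = 4` then `⟨E_v, E_O⟩ + ⟨E_v, E_{O₁}⟩ = ±2` for every row `v`** (`E_{O₁} = −E_O` except in one coordinate) -/
theorem inner_add_inner_of_ip_four (h : IsSignSystem I m E Es R) {O O₁ : Fin 16} (hne : O ≠ O₁) (h4 : ip R O O₁ = 4) (v : Fin 16) :
    ∑ x, E v x * E O x + ∑ x, E v x * E O₁ x = 2 ∨ ∑ x, E v x * E O x + ∑ x, E v x * E O₁ x = -2 := by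
  have hnd : ndiff E O O₁ = 6 := by have := ip_eq h hne; omega
  have hag : (univ.filter fun x => E O x = E O₁ x).card = 1 := by
    have e := Finset.card_filter_add_card_filter_not (s := (univ : Finset (Fin 7))) (fun x => E O x = E O₁ x)
    unfold ndiff at hnd
    simp only [card_univ, Fintype.card_fin] at e
    simp only [ne_eq] at hnd
    omega
  obtain ⟨a, ha⟩ := Finset.card_eq_one.1 hag
  have e : ∀ x, E v x * E O x + E v x * E O₁ x = if E O x = E O₁ x then 2 * (E v x * E O x) else 0 := by
    intro x
    split_ifs with hx
    · rw [hx]; ring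
    · rcases h.E_sign O x with h1 | h1 <;> rcases h.E_sign O₁ x with h2 | h2
      · exact absurd (h1.trans h2.symm) hx
      · rw [h1, h2]; ring
      · rw [h1, h2]; ring
      · exact absurd (h1.trans h2.symm) hx
  rw [← Finset.sum_add_distrib, Finset.sum_congr rfl fun x _ => e x, Finset.sum_ite, Finset.sum_const_zero, add_zero, ha,
    Finset.sum_singleton]
  rcases h.E_sign v a with h1 | h1 <;> rcases h.E_sign O a with h2 | h2 <;> norm_num [h1, h2]

/-- **chord-mates:** two distinct rows sharing a `2`-column have `ip = 4` -/
theorem ip_eq_four_of_two_two (h : IsSignSystem I m E Es R) {O X : Fin 16} (hne : O ≠ X) {N : Fin 16} (hO : R O N = 2) (hX : R X N = 2) :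
    ip R O X = 4 := by
  have h1 := term_le_ip h O X N
  rw [hO, hX] at h1
  rcases ip_mem h hne with h2 | h2 | h2 <;> omega

/-- the other `2`-row of a column -/
theorem other_two_row (h : IsSignSystem I m E Es R) {O N : Fin 16} (hO : R O N = 2) :
    ∃ Y, Y ≠ O ∧ R Y N = 2 ∧ ∀ Z, R Z N = 2 → Z = O ∨ Z = Y := by
  obtain ⟨a, b, hab, hs⟩ := Finset.card_eq_two.1 (h.R_col_profile N).1
  have hmem : ∀ Z, R Z N = 2 ↔ Z = a ∨ Z = b := fun Z => by
    have : Z ∈ (univ.filter fun W => R W N = 2) ↔ Z ∈ ({a, b} : Finset (Fin 16)) := by rw [hs]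
    simpa using this
  rcases (hmem O).1 hO with rfl | rfl
  · exact ⟨b, hab.symm, (hmem b).2 (Or.inr rfl), fun Z hZ => (hmem Z).1 hZ⟩
  · exact ⟨a, hab, (hmem a).2 (Or.inl rfl), fun Z hZ => ((hmem Z).1 hZ).symm⟩

/-- the two `2`-columns of a row -/
theorem two_cols (h : IsSignSystem I m E Es R) (O : Fin 16) :
    ∃ N₁ N₂, N₁ ≠ N₂ ∧ R O N₁ = 2 ∧ R O N₂ = 2 ∧ ∀ N, R O N = 2 → N = N₁ ∨ N = N₂ := by
  obtain ⟨a, b, hab, hs⟩ := Finset.card_eq_two.1 (h.R_row_profile O).1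
  have hmem : ∀ N, R O N = 2 ↔ N = a ∨ N = b := fun N => by
    have : N ∈ (univ.filter fun W => R O W = 2) ↔ N ∈ ({a, b} : Finset (Fin 16)) := by rw [hs]
    simpa using this
  exact ⟨a, b, hab, (hmem a).2 (Or.inl rfl), (hmem b).2 (Or.inr rfl), fun N hN => (hmem N).1 hN⟩

/-- **a `(2,1)` coincidence forces `ip ≠ 4`** -/
theorem ip_ne_four_of_two_one (h : IsSignSystem I m E Es R) {O X N : Fin 16} (hO : R O N = 2) (hX : R X N = 1) : ip R O X ≠ 4 := by
  intro h4
  have hOX : O ≠ X := by rintro rfl; omega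
  obtain ⟨Y, hYO, hY, -⟩ := other_two_row h hO
  have hOY : ip R O Y = 4 := ip_eq_four_of_two_two h hYO.symm hO hY
  have hXY : X ≠ Y := by rintro rfl; omega
  have hT := inner_add_inner_of_ip_four h hYO.symm hOY X
  have i1 : ∑ x, E X x * E O x = -5 := by
    rw [inner_eq_of_ne h hOX.symm, ip_comm, h4]; norm_num
  have i2 : ∑ x, E X x * E Y x ≤ -1 := by
    rw [inner_eq_of_ne h hXY]
    have ht := term_le_ip h X Y N
    rw [hX, hY] at ht
    linarith
  rcases hT with hT | hT <;> linarith

/-- **a `(1,2)` coincidence forces `ip ≠ 4`** -/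
theorem ip_ne_four_of_one_two (h : IsSignSystem I m E Es R) {O X N : Fin 16} (hO : R O N = 1) (hX : R X N = 2) : ip R O X ≠ 4 := by
  rw [ip_comm]
  exact ip_ne_four_of_two_one h hX hO

/-- **`ip(O, X) = 4` only for chord-mates** -/
theorem exists_two_two_of_ip_four (h : IsSignSystem I m E Es R) {O X : Fin 16} (h4 : ip R O X = 4) :
    ∃ N, R O N = 2 ∧ R X N = 2 := by
  by_contra hno
  push Not at hno
  have key : ∀ N, R O N * R X N = if R O N = 1 ∧ R X N = 1 then (1 : ℤ) else 0 := by
    intro N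
    rcases h.R_range O N with h1 | h1 | h1 <;> rcases h.R_range X N with h2 | h2 | h2 <;>
      first
        | exact absurd h4 (ip_ne_four_of_one_two h h1 h2)
        | exact absurd h4 (ip_ne_four_of_two_one h h1 h2)
        | exact absurd h2 (hno N h1)
        | norm_num [h1, h2]
  have e : ip R O X = sh R O X := by
    unfold ip sh
    rw [Finset.sum_congr rfl fun N _ => key N, Finset.sum_boole]
  have := sh_le_two h O X
  omega

/-- **exactly two rows at `ip = 4`** (the two chord-mates) -/
theorem card_ip_four (h : IsSignSystem I m E Es R) (O : Fin 16) : ((univ.erase O).filter fun X => ip R O X = 4).card = 2 := by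
  obtain ⟨N₁, N₂, hN, hN₁, hN₂, honly⟩ := two_cols h O
  obtain ⟨X₁, hX₁O, hX₁, huniq₁⟩ := other_two_row h hN₁
  obtain ⟨X₂, hX₂O, hX₂, huniq₂⟩ := other_two_row h hN₂
  have hX : X₁ ≠ X₂ := by
    intro e
    subst e
    have hle : ∑ N ∈ ({N₁, N₂} : Finset (Fin 16)), R O N * R X₁ N ≤ ip R O X₁ := by
      unfold ip
      refine Finset.sum_le_sum_of_subset_of_nonneg (Finset.subset_univ _) fun N' _ _ => mul_nonneg ?_ ?_
      · rcases h.R_range O N' with h1 | h1 | h1 <;> rw [h1] <;> norm_num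
      · rcases h.R_range X₁ N' with h1 | h1 | h1 <;> rw [h1] <;> norm_num
    rw [Finset.sum_pair hN, hN₁, hX₁, hN₂, hX₂] at hle
    rcases ip_mem h hX₁O.symm with h2 | h2 | h2 <;> omega
  have hs : ((univ.erase O).filter fun X => ip R O X = 4) = {X₁, X₂} := by
    ext X
    simp only [Finset.mem_filter, Finset.mem_erase, mem_univ, and_true, Finset.mem_insert, Finset.mem_singleton]
    constructor
    · rintro ⟨hXO, h4⟩
      obtain ⟨N, hON, hXN⟩ := exists_two_two_of_ip_four h h4
      rcases honly N hON with rfl | rfl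
      · rcases huniq₁ X hXN with e | e
        · exact absurd e hXO
        · exact Or.inl e
      · rcases huniq₂ X hXN with e | e
        · exact absurd e hXO
        · exact Or.inr e
    · rintro (rfl | rfl)
      · exact ⟨hX₁O, ip_eq_four_of_two_two h hX₁O.symm hN₁ hX₁⟩
      · exact ⟨hX₂O, ip_eq_four_of_two_two h hX₂O.symm hN₂ hX₂⟩
  rw [hs, Finset.card_pair hX]

/-- **exactly nine rows at `ip = 2` and four at `ip = 0`** -/
theorem card_ip_two_zero (h : IsSignSystem I m E Es R) (O : Fin 16) :
    ((univ.erase O).filter fun X => ip R O X = 2).card = 9 ∧ ((univ.erase O).filter fun X => ip R O X = 0).card = 4 := by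
  have h4 := card_ip_four h O
  have h26 := sum_ip_erase h O
  have e1 : ∑ X ∈ univ.erase O, ip R O X =
      ∑ X ∈ univ.erase O, (2 * (if ip R O X = 2 then 1 else 0 : ℤ) + 4 * (if ip R O X = 4 then 1 else 0 : ℤ)) := by
    refine Finset.sum_congr rfl fun X hX => ?_
    rcases ip_mem h (Ne.symm (Finset.ne_of_mem_erase hX)) with h1 | h1 | h1 <;> norm_num [h1]
  have e2 : ∑ X ∈ univ.erase O, (1 : ℤ) =
      ∑ X ∈ univ.erase O, ((if ip R O X = 0 then 1 else 0 : ℤ) + (if ip R O X = 2 then 1 else 0 : ℤ) + (if ip R O X = 4 then 1 else 0 : ℤ)) := by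
    refine Finset.sum_congr rfl fun X hX => ?_
    rcases ip_mem h (Ne.symm (Finset.ne_of_mem_erase hX)) with h1 | h1 | h1 <;> norm_num [h1]
  rw [Finset.sum_add_distrib, ← Finset.mul_sum, ← Finset.mul_sum, Finset.sum_boole, Finset.sum_boole] at e1
  rw [Finset.sum_add_distrib, Finset.sum_add_distrib, Finset.sum_boole, Finset.sum_boole, Finset.sum_boole] at e2
  have e3 : ∑ X ∈ univ.erase O, (1 : ℤ) = 15 := by
    rw [Finset.sum_const, Finset.card_erase_of_mem (mem_univ O)]; simp
  rw [h4] at e1 e2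
  constructor <;> omega

/-- **from every row of `E`, exactly `2` rows at inner product `−5`** (Hamming distance `6`) … -/
theorem card_inner_neg_five (h : IsSignSystem I m E Es R) (O : Fin 16) : (univ.filter fun X => ∑ x, E O x * E X x = -5).card = 2 := by
  rw [← card_ip_four h O]
  congr 1
  ext X
  simp only [Finset.mem_filter, mem_univ, true_and, Finset.mem_erase, and_true]
  by_cases hXO : X = O
  · subst hXO
    rw [inner_self h]
    constructor
    · intro h7; norm_num at h7
    · rintro ⟨hne, -⟩; exact absurd rfl hne
  · rw [inner_eq_of_ne h (Ne.symm hXO)]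
    constructor
    · intro hi; exact ⟨hXO, by omega⟩
    · rintro ⟨-, hi⟩; omega

/-- … exactly `9` rows at inner product `−1` (Hamming distance `4`) … -/
theorem card_inner_neg_one (h : IsSignSystem I m E Es R) (O : Fin 16) : (univ.filter fun X => ∑ x, E O x * E X x = -1).card = 9 := by
  rw [← (card_ip_two_zero h O).1]
  congr 1
  ext X
  simp only [Finset.mem_filter, mem_univ, true_and, Finset.mem_erase, and_true]
  by_cases hXO : X = O
  · subst hXO
    rw [inner_self h]
    constructor
    · intro h7; norm_num at h7
    · rintro ⟨hne, -⟩; exact absurd rfl hne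
  · rw [inner_eq_of_ne h (Ne.symm hXO)]
    constructor
    · intro hi; exact ⟨hXO, by omega⟩
    · rintro ⟨-, hi⟩; omega

/-- … and exactly `4` rows at inner product `3` (Hamming distance `2`). -/
theorem card_inner_three (h : IsSignSystem I m E Es R) (O : Fin 16) : (univ.filter fun X => ∑ x, E O x * E X x = 3).card = 4 := by
  rw [← (card_ip_two_zero h O).2]
  congr 1
  ext X
  simp only [Finset.mem_filter, mem_univ, true_and, Finset.mem_erase, and_true]
  by_cases hXO : X = O
  · subst hXO
    rw [inner_self h]
    constructor
    · intro h7; norm_num at h7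
    · rintro ⟨hne, -⟩; exact absurd rfl hne
  · rw [inner_eq_of_ne h (Ne.symm hXO)]
    constructor
    · intro hi; exact ⟨hXO, by omega⟩
    · rintro ⟨-, hi⟩; omega

end IsSignSystem

end FanoFive

end Summit.Ventures.DiscreteObjects.PP12
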